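import Summits.SmoothPoincare4.SmoothPoincare4.Theorems.SymplecticOrigamiGromovRecognitionRelEndStubCapModelAux2
import Literature.Geometry.Symplectic.GromovR4StdModel

/-!
# Wedge cap for `GromovRecognitionRelEnd` — the split radial area forms on `ℝ⁴ = ℂ²`
(stub `stub_capModel` of line `cross-cap-laurent`, crux `SymplecticOrigami.GromovRecognitionRelEnd`,
item stmt-SmoothPoincare4-11009; third auxiliary file)

The closed `2`-form of the wedge cap is, in every chart, a SPLIT RADIAL form
`Ω[a, b] = a(|z₁|²) dx₀ ∧ dx₁ + b(|z₂|²) dx₂ ∧ dx₃` on `ℂ² = ℝ⁴` (tree type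
`MForm (𝓡 4) E4 ℝ 2`). This file proves, for smooth profiles `a, b : ℝ → ℝ`:

* `capForm a b` is a smooth form (`isSmoothForm_capForm`) and is CLOSED (`isClosedForm_capForm`:
  `d(a(|z₁|²)) ∧ dx₀ ∧ dx₁` is a `3`-form in the two variables `x₀, x₁` only, hence `0`);
* `Ω[a,b](q, (i ⊕ i) q) = a |q₁|² + b |q₂|²` (`capForm_apply_I4`), positive for positive profiles
  (`capForm_I4_pos`) — the taming inequality;
* the pull-back under the complex inversion of the first factor is again split radial:
  `inv1^* Ω[a, b] = Ω[â, b]`, `â(s) = a(s⁻¹) s⁻²` (`capForm_pullback_inv1`), and symmetrically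
  `inv2^* Ω[a, b] = Ω[a, b̂]`.
-/

noncomputable section

-- the registered namespace `Summit.SmoothPoincare4.SmoothPoincare4.Theorems…` repeats a component
set_option linter.dupNamespace false

open scoped Manifold ContDiff Topology
open Set Literature.Geometry.Kaehler Literature.Geometry.Symplectic

namespace Summit.SmoothPoincare4.SmoothPoincare4.Theorems.GromovRecognitionRelEnd.CrossCapLaurent

namespace CapModel

/-- Model space `ℝ⁴ = ℂ²` (coordinates `0,1` = `z₁`, `2,3` = `z₂`). -/
local notation "E4" => EuclideanSpace ℝ (Fin 4)

/-! ## The coordinate area forms as continuous alternating maps -/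

/-- The projection `(z₁, z₂) ↦ (z₁, 0)` as a linear map. [folklore] -/
def P01ₗ : E4 →ₗ[ℝ] E4 where
  toFun q := WithLp.toLp 2 ![q 0, q 1, 0, 0]
  map_add' q q' := by ext i; fin_cases i <;> simp
  map_smul' c q := by ext i; fin_cases i <;> simp

/-- The projection `(z₁, z₂) ↦ (0, z₂)` as a linear map. [folklore] -/
def P23ₗ : E4 →ₗ[ℝ] E4 where
  toFun q := WithLp.toLp 2 ![0, 0, q 2, q 3]
  map_add' q q' := by ext i; fin_cases i <;> simp
  map_smul' c q := by ext i; fin_cases i <;> simp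

/-- The projection `(z₁, z₂) ↦ (z₁, 0)`. [folklore] -/
def P01 : E4 →L[ℝ] E4 := LinearMap.toContinuousLinearMap P01ₗ

/-- The projection `(z₁, z₂) ↦ (0, z₂)`. [folklore] -/
def P23 : E4 →L[ℝ] E4 := LinearMap.toContinuousLinearMap P23ₗ

/-- `P01 q = (q₀, q₁, 0, 0)`. [folklore] -/
theorem P01_apply (q : E4) : P01 q = WithLp.toLp 2 ![q 0, q 1, 0, 0] := rfl

/-- `P23 q = (0, 0, q₂, q₃)`. [folklore] -/
theorem P23_apply (q : E4) : P23 q = WithLp.toLp 2 ![0, 0, q 2, q 3] := rfl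

/-- `dx₀ ∧ dx₁` as a continuous alternating `2`-form on `ℝ⁴` (`ω₀` precomposed with `P01`). [folklore] -/
def A01 : E4 [⋀^Fin 2]→L[ℝ] ℝ := stdSymplecticAlt.compContinuousLinearMap P01

/-- `dx₂ ∧ dx₃` as a continuous alternating `2`-form on `ℝ⁴`. [folklore] -/
def A23 : E4 [⋀^Fin 2]→L[ℝ] ℝ := stdSymplecticAlt.compContinuousLinearMap P23

/-- `A01 (v, w) = v₀w₁ - v₁w₀`. [folklore] -/
@[simp] theorem A01_apply (v w : E4) : A01 ![v, w] = ar01 v w := by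
  have h : (fun i => P01 (![v, w] i)) = ![P01 v, P01 w] := by
    funext i; fin_cases i <;> rfl
  rw [A01, ContinuousAlternatingMap.compContinuousLinearMap_apply, Function.comp_def, h,
    stdSymplecticAlt_apply, stdSymplecticForm, ar01_def]
  simp [P01_apply]

/-- `A23 (v, w) = v₂w₃ - v₃w₂`. [folklore] -/
@[simp] theorem A23_apply (v w : E4) : A23 ![v, w] = ar23 v w := by
  have h : (fun i => P23 (![v, w] i)) = ![P23 v, P23 w] := by
    funext i; fin_cases i <;> rfl
  rw [A23, ContinuousAlternatingMap.compContinuousLinearMap_apply, Function.comp_def, h,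
    stdSymplecticAlt_apply, stdSymplecticForm, ar23_def]
  simp [P23_apply]

/-- Two `2`-forms agreeing on all pairs are equal. [folklore] -/
theorem twoForm_ext {V : Type*} [AddCommGroup V] [Module ℝ V] [TopologicalSpace V]
    {A B : V [⋀^Fin 2]→L[ℝ] ℝ} (h : ∀ v w, A ![v, w] = B ![v, w]) : A = B := by
  ext u
  have hu : u = ![u 0, u 1] := by funext i; fin_cases i <;> rfl
  rw [hu]; exact h _ _

/-! ## The split radial forms -/

/-- **The split radial form** `Ω[a, b] = a(|z₁|²) dx₀ ∧ dx₁ + b(|z₂|²) dx₂ ∧ dx₃` on `ℂ² = ℝ⁴`, as a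
map into `2`-forms (for `a = b = 1` this is `ω₀`). [cite: McDuffSalamon2017, §1.1 (1.1.20)] -/
def capFormE (a b : ℝ → ℝ) (p : E4) : E4 [⋀^Fin 2]→L[ℝ] ℝ := a (r1 p) • A01 + b (r2 p) • A23

/-- The split radial form as a form on the manifold `ℝ⁴` (tree type `MForm`). [folklore] -/
def capForm (a b : ℝ → ℝ) : MForm (𝓡 4) E4 ℝ 2 := fun p => capFormE a b p

/-- `capForm` is `capFormE` pointwise. [folklore] -/
theorem capForm_eq (a b : ℝ → ℝ) (p : E4) : capForm a b p = capFormE a b p := rfl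

/-- `Ω[a,b]_p (v, w) = a(|z₁|²)(v₀w₁ - v₁w₀) + b(|z₂|²)(v₂w₃ - v₃w₂)`. [folklore] -/
theorem capForm_apply (a b : ℝ → ℝ) (p : E4) (v w : E4) :
    capForm a b p ![v, w] = a (r1 p) * ar01 v w + b (r2 p) * ar23 v w := by
  show (a (r1 p) • A01 + b (r2 p) • A23) ![v, w] = _
  simp

/-- **The taming identity**: `Ω[a,b]_p (q, (i⊕i) q) = a(|z₁|²) |q₁|² + b(|z₂|²) |q₂|²`. [folklore] -/
theorem capForm_apply_I4 (a b : ℝ → ℝ) (p q : E4) :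
    capForm a b p ![q, I4 q] = a (r1 p) * r1 q + b (r2 p) * r2 q := by
  rw [capForm_apply, ar01_I4, ar23_I4]

/-- **Positive split radial forms tame `i ⊕ i`**: `Ω[a,b]_p (q, (i⊕i) q) > 0` for `q ≠ 0` when
`a, b > 0`. [cite: McDuffSalamon2017, §4.1 (4.1.1)] -/
theorem capForm_I4_pos {a b : ℝ → ℝ} (ha : ∀ s, 0 < a s) (hb : ∀ s, 0 < b s) (p : E4) {q : E4}
    (hq : q ≠ 0) : 0 < capForm a b p ![q, I4 q] := by
  rw [capForm_apply_I4]
  have h1 := r1_nonneg q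
  have h2 := r2_nonneg q
  have hsum : 0 < r1 q + r2 q := by
    rw [← norm_sq_eq_r1_add_r2]; positivity
  rcases lt_or_eq_of_le h1 with h1' | h1'
  · exact add_pos_of_pos_of_nonneg (mul_pos (ha _) h1') (mul_nonneg (hb _).le h2)
  · have h2' : 0 < r2 q := by linarith
    exact add_pos_of_nonneg_of_pos (mul_nonneg (ha _).le h1) (mul_pos (hb _) h2')

/-- The chart representative of a form on the model space `ℝ⁴` is the form itself. [folklore] -/
theorem inChart_eq_self (α : MForm (𝓡 4) E4 ℝ 2) (x : E4) : α.inChart x = α := by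
  funext y
  ext v
  simp [MForm.inChart_apply]
  rfl

/-- `Ω[a,b]` is `C^∞` as a map into `2`-forms, for smooth profiles. [folklore] -/
theorem contDiff_capFormE {a b : ℝ → ℝ} (ha : ContDiff ℝ ∞ a) (hb : ContDiff ℝ ∞ b) :
    ContDiff ℝ ∞ (capFormE a b) :=
  ((ha.comp contDiff_r1).smul contDiff_const).add ((hb.comp contDiff_r2).smul contDiff_const)

/-- **`Ω[a,b]` is a smooth form** for smooth profiles. [folklore] -/
theorem isSmoothForm_capForm {a b : ℝ → ℝ} (ha : ContDiff ℝ ∞ a) (hb : ContDiff ℝ ∞ b) :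
    IsSmoothForm (capForm a b) := by
  intro x
  rw [inChart_eq_self]
  exact ((contDiff_capFormE ha hb).contDiffAt (x := extChartAt (𝓡 4) x x)).contDiffWithinAt

/-- The scalar components `y ↦ Ω[a,b]_y (u)` and their derivatives: with `a' = a'(|z₁|²)`,
`b' = b'(|z₂|²)`, `∂_w Ω_y(u) = 2a'(y₀w₀ + y₁w₁) A01 u + 2b'(y₂w₂ + y₃w₃) A23 u`. [folklore] -/
theorem fderiv_capForm_apply {a b : ℝ → ℝ} (ha : ContDiff ℝ ∞ a) (hb : ContDiff ℝ ∞ b) (x : E4)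
    (u : Fin 2 → E4) (w : E4) :
    fderiv ℝ (fun y => capFormE a b y u) x w =
      deriv a (r1 x) * (2 * (x 0 * w 0 + x 1 * w 1)) * A01 u +
        deriv b (r2 x) * (2 * (x 2 * w 2 + x 3 * w 3)) * A23 u := by
  have hfun : (fun y => capFormE a b y u) = fun y => a (r1 y) * A01 u + b (r2 y) * A23 u := by
    funext y
    show (a (r1 y) • A01 + b (r2 y) • A23) u = _
    simp
  rw [hfun]
  have hA : HasFDerivAt (fun y => a (r1 y))
      (deriv a (r1 x) • (x 0 • pr 0 + x 0 • pr 0 + (x 1 • pr 1 + x 1 • pr 1))) x :=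
    ((ha.differentiable (by simp)) _).hasDerivAt.comp_hasFDerivAt x (hasFDerivAt_r1 x)
  have hB : HasFDerivAt (fun y => b (r2 y))
      (deriv b (r2 x) • (x 2 • pr 2 + x 2 • pr 2 + (x 3 • pr 3 + x 3 • pr 3))) x :=
    ((hb.differentiable (by simp)) _).hasDerivAt.comp_hasFDerivAt x (hasFDerivAt_r2 x)
  have hS : HasFDerivAt (fun y => a (r1 y) * A01 u + b (r2 y) * A23 u)
      (A01 u • deriv a (r1 x) • (x 0 • pr 0 + x 0 • pr 0 + (x 1 • pr 1 + x 1 • pr 1)) +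
        A23 u • deriv b (r2 x) • (x 2 • pr 2 + x 2 • pr 2 + (x 3 • pr 3 + x 3 • pr 3))) x :=
    (hA.mul_const (A01 u)).add (hB.mul_const (A23 u))
  rw [hS.fderiv]
  simp
  ring

/-- **`Ω[a,b]` is closed**: `dΩ = 2a'(x₀dx₀ + x₁dx₁) ∧ dx₀ ∧ dx₁ + 2b'(x₂dx₂ + x₃dx₃) ∧ dx₂ ∧ dx₃ = 0`
(each summand is a `3`-form in two variables). [folklore] -/
theorem isClosedForm_capForm {a b : ℝ → ℝ} (ha : ContDiff ℝ ∞ a) (hb : ContDiff ℝ ∞ b) :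
    IsClosedForm (capForm a b) := by
  show mextDeriv (capForm a b) = 0
  funext x
  show mextDeriv (capForm a b) x = 0
  rw [show mextDeriv (capForm a b) x = extDeriv (capFormE a b) x from mextDeriv_eq_extDeriv _ x]
  have hdiff : DifferentiableAt ℝ (capFormE a b) x :=
    (contDiff_capFormE ha hb).differentiable (by simp) x
  ext v
  show extDeriv (capFormE a b) x v = (0 : ℝ)
  rw [extDeriv_apply hdiff, Fin.sum_univ_three]
  simp only [fderiv_capForm_apply ha hb]
  have e0 : Fin.removeNth (0 : Fin 3) v = ![v 1, v 2] := by
    funext j; fin_cases j <;> rfl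
  have e1 : Fin.removeNth (1 : Fin 3) v = ![v 0, v 2] := by
    funext j; fin_cases j <;> rfl
  have e2 : Fin.removeNth (2 : Fin 3) v = ![v 0, v 1] := by
    funext j; fin_cases j <;> rfl
  rw [e0, e1, e2]
  simp only [A01_apply, A23_apply, ar01_def, ar23_def, Fin.val_zero, Fin.val_one, Fin.val_two,
    pow_zero, pow_one, one_smul, neg_smul]
  ring

/-! ## Pull-back of the split radial forms under the inversions -/

/-- The profile transformed by an inversion: `â(s) = a(s⁻¹) s⁻²`. [folklore] -/
def hatP (a : ℝ → ℝ) (s : ℝ) : ℝ := a s⁻¹ * s⁻¹ ^ 2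

/-- Unfolding `hatP`. [folklore] -/
theorem hatP_apply (a : ℝ → ℝ) (s : ℝ) : hatP a s = a s⁻¹ * s⁻¹ ^ 2 := rfl

/-- `hatP` is an involution on profiles, off `s = 0`. [folklore] -/
theorem hatP_hatP (a : ℝ → ℝ) {s : ℝ} (hs : s ≠ 0) : hatP (hatP a) s = a s := by
  simp only [hatP, inv_inv]
  field_simp

/-- A positive profile has a positive transform (off `s = 0`; at `s = 0` the value is the junk
`a 0 * 0`, irrelevant). [folklore] -/
theorem hatP_pos {a : ℝ → ℝ} (ha : ∀ s, 0 < a s) {s : ℝ} (hs : s ≠ 0) : 0 < hatP a s :=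
  mul_pos (ha _) (by positivity)

/-- **`inv1^* Ω[a, b] = Ω[â, b]`** off the axis `z₁ = 0`: the area form of the `z₁`-plane picks up
the Jacobian `|z₁|⁻⁴` and `|1/z₁|² = |z₁|⁻²`. [folklore] -/
theorem capForm_pullback_inv1 (a b : ℝ → ℝ) {p : E4} (h : r1 p ≠ 0) :
    (capForm a b).pullback 𝓘(ℝ, E4) inv1 p = capForm (hatP a) b p := by
  refine twoForm_ext fun v w => ?_
  rw [MForm.pullback_apply]
  have hv : (fun i => mfderiv 𝓘(ℝ, E4) 𝓘(ℝ, E4) inv1 p (![v, w] i)) =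
      ![fderiv ℝ inv1 p v, fderiv ℝ inv1 p w] := by
    funext i; fin_cases i <;> simp [mfderiv_eq_fderiv] <;> rfl
  rw [hv]
  show capForm a b (inv1 p) ![fderiv ℝ inv1 p v, fderiv ℝ inv1 p w] = _
  rw [capForm_apply, capForm_apply, ar01_fderiv_inv1 h, ar23_fderiv_inv1 h, r1_inv1, r2_inv1,
    hatP_apply]
  ring

/-- **`inv2^* Ω[a, b] = Ω[a, b̂]`** off the axis `z₂ = 0`. [folklore] -/
theorem capForm_pullback_inv2 (a b : ℝ → ℝ) {p : E4} (h : r2 p ≠ 0) :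
    (capForm a b).pullback 𝓘(ℝ, E4) inv2 p = capForm a (hatP b) p := by
  refine twoForm_ext fun v w => ?_
  rw [MForm.pullback_apply]
  have hv : (fun i => mfderiv 𝓘(ℝ, E4) 𝓘(ℝ, E4) inv2 p (![v, w] i)) =
      ![fderiv ℝ inv2 p v, fderiv ℝ inv2 p w] := by
    funext i; fin_cases i <;> simp [mfderiv_eq_fderiv] <;> rfl
  rw [hv]
  show capForm a b (inv2 p) ![fderiv ℝ inv2 p v, fderiv ℝ inv2 p w] = _
  rw [capForm_apply, capForm_apply, ar01_fderiv_inv2 h, ar23_fderiv_inv2 h, r1_inv2, r2_inv2,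
    hatP_apply]
  ring

/-- `Ω[1, 1] = ω₀` pointwise on pairs. [cite: McDuffSalamon2017, §1.1 (1.1.20)] -/
theorem capForm_one_one_apply (p v w : E4) :
    capForm (fun _ => 1) (fun _ => 1) p ![v, w] = stdSymplecticForm v w := by
  rw [capForm_apply, ar01_def, ar23_def, stdSymplecticForm]; ring

/-- Where both profiles take the value `1`, `Ω[a, b]` is `ω₀`. [folklore] -/
theorem capForm_apply_of_eq_one {a b : ℝ → ℝ} {p : E4} (ha : a (r1 p) = 1) (hb : b (r2 p) = 1)
    (v w : E4) : capForm a b p ![v, w] = stdSymplecticForm v w := by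
  rw [capForm_apply, ha, hb, ar01_def, ar23_def, stdSymplecticForm]; ring

end CapModel

/-- **Registered helper sub-goal `helper_capModelSplitFormClosed`** (third auxiliary file of stub
`stub_capModel`): every split radial form `a(|z₁|²) dx₀∧dx₁ + b(|z₂|²) dx₂∧dx₃` with smooth
profiles is a smooth closed `2`-form on `ℝ⁴` (tree predicates `IsSmoothForm`, `IsClosedForm`).
[folklore] -/
theorem helper_capModelSplitFormClosed : ∀ a b : ℝ → ℝ, ContDiff ℝ ∞ a → ContDiff ℝ ∞ b →
    ∃ Ω : Literature.Geometry.Kaehler.MForm (𝓡 4) (EuclideanSpace ℝ (Fin 4)) ℝ 2,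
      Literature.Geometry.Kaehler.IsSmoothForm Ω ∧ Literature.Geometry.Kaehler.IsClosedForm Ω ∧
      ∀ p v w : EuclideanSpace ℝ (Fin 4), Ω p ![v, w] =
        a (p 0 ^ 2 + p 1 ^ 2) * (v 0 * w 1 - v 1 * w 0) + b (p 2 ^ 2 + p 3 ^ 2) * (v 2 * w 3 - v 3 * w 2) :=
  fun a b ha hb => ⟨CapModel.capForm a b, CapModel.isSmoothForm_capForm ha hb,
    CapModel.isClosedForm_capForm ha hb, fun p v w => CapModel.capForm_apply a b p v w⟩

end Summit.SmoothPoincare4.SmoothPoincare4.Theorems.GromovRecognitionRelEnd.CrossCapLaurent
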